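import Mathlib
import Summits.NavierStokesRegularity.NavierStokesRegularity.Theorems.EulerZoomLiouvillePowerGaugeEulerLiouvilleRigidFrameTensorTest
import HarnessLib

/-!
# RIGID-FRAME-STEADY MEMBERS: THE BODY-FRAME IDENTITY `∫⟪U, DΦ(A· + v) − AΦ⟫ = ∫⟪U, DΦ U⟫` AND ITS TWO-TIME DIFFERENCE
# (crux `EulerZoomLiouville.PowerGaugeEulerLiouville` = stmt-NavierStokesRegularity-19832; «E(3)-steady, escaping» stratum, step (iii); width seat ns-ezl-w3 g5)

Route №10 `EulerZoomLiouville`, crux E.  For a rigid-frame-steady member `u(τ, x) = R(τ) U(R(τ)⁻¹(x − ξ(τ)))` (`τ < T₁ ≤ 0`, `R, ξ ∈ C¹`, `R(τ)` linear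
isometries with continuous inverse path `R⁻¹`, `U, |U|² ∈ L¹_loc`, distributional Euler pair) the lab-frame velocity identity
(`RigidFrame.integral_inner_fderiv_rigid_eq`) becomes, after transporting the test field to the body frame, STEADY EULER IN A ROTATING, TRANSLATING FRAME:

* `RigidFrame.bodyFrame_identity` — for every divergence-free test field `Φ` and every `τ < T₁`,
  `∫ ⟪U, DΦ(w)(A(τ)w + v(τ)) − A(τ)Φ(w)⟫ dw = ∫ ⟪U, DΦ(w) U(w)⟫ dw`, with the BODY ANGULAR VELOCITY `A(τ) = R(τ)⁻¹R′(τ)` (skew: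
  `RigidFrame.inner_bodyAngular_skew`) and the body velocity `v(τ) = R(τ)⁻¹ξ′(τ)` — i.e. `(U·∇)U + ∇q = L_κ U`, `κ(w) = A w + v` a Killing field;
* `RigidFrame.bodyFrame_twoTime` — the right side does not depend on `τ`, so for `τ₁, τ₂ < T₁` the Lie derivative of `U` along the Killing field
  `κ = (A(τ₁) − A(τ₂))w + (v(τ₁) − v(τ₂))` is WEAKLY A GRADIENT: `∫ ⟪U, DΦ(w)(κ w) − (A(τ₁) − A(τ₂))Φ(w)⟫ = 0` — the hypothesis of
  `Killing.screwShearVanishes` (after recentring `κ` to screw form);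
* `RigidFrame.rigidProfile_integral_inner_gradient_eq_zero` — the profile `U` is weakly divergence free.

What remains for the stratum «E(3)-steady members are trivial» (next seat): recentre `κ`, apply `Killing.screwShearVanishes`, and run the symmetry bookkeeping
(non-zero pitch/translation ⇒ `ScrewSymmetric`/`FrozenDirection` kills; several rotation axes ⇒ translations or `SO(3)`-invariance; one axis ⇒ uniform screw frame ⇒
`RigidFrame.ae_eq_zero_of_gauge_of_pastRigidFrameSteady_confined` with `β = 1`).

WHAT THIS IS NOT: not NS regularity, not the crux E — slice identities toward one more symmetry stratum of the crux CLASS 19832 (MODEL lattice; E/NS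
strata), `--supports` stmt-19832; 19832 OPEN. [folklore; MajdaBertozzi2002 Prop. 1.1 p. 12 (moving frames)]
-/

noncomputable section

-- flat `Theorems/<Route><Decl>…` files of one crux share the namespace of the crux (tree convention: `Summit.<S>.<S>.…`)
set_option linter.dupNamespace false

open MeasureTheory Set Filter Topology Metric Function TopologicalSpace InnerProductSpace
open scoped ENNReal NNReal RealInnerProductSpace ContDiff

namespace Summit.NavierStokesRegularity.NavierStokesRegularity.Theorems.PowerGaugeEulerLiouville

namespace RigidFrame

open Literature.Analysis Literature.Analysis.FunctionSpaces Literature.Analysis.FluidPDE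
open Summit.NavierStokesRegularity.NavierStokesRegularity.Theorems.PowerGaugeEulerLiouville.GalileanFrames

variable {U : EuclideanSpace ℝ (Fin 3) → EuclideanSpace ℝ (Fin 3)} {ξ : ℝ → EuclideanSpace ℝ (Fin 3)}
  {R Rinv : ℝ → EuclideanSpace ℝ (Fin 3) →L[ℝ] EuclideanSpace ℝ (Fin 3)}
  {u : ℝ → EuclideanSpace ℝ (Fin 3) → EuclideanSpace ℝ (Fin 3)} {p : ℝ → EuclideanSpace ℝ (Fin 3) → ℝ} {T₁ : ℝ}

/-! ### Linear isometries: inner products, adjoints, skewness of the body angular velocity -/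

/-- A norm-preserving linear map preserves inner products (polarisation). [folklore] -/
theorem inner_map_map_of_norm_map (L : EuclideanSpace ℝ (Fin 3) →L[ℝ] EuclideanSpace ℝ (Fin 3)) (hL : ∀ w, ‖L w‖ = ‖w‖)
    (a b : EuclideanSpace ℝ (Fin 3)) : ⟪L a, L b⟫ = ⟪a, b⟫ := by
  rw [real_inner_eq_norm_add_mul_self_sub_norm_mul_self_sub_norm_mul_self_div_two, ← map_add, hL, hL, hL,
    ← real_inner_eq_norm_add_mul_self_sub_norm_mul_self_sub_norm_mul_self_div_two]

/-- The adjoint of an invertible isometry is its inverse: `⟪x, L b⟫ = ⟪L⁻¹ x, b⟫`. [folklore] -/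
theorem inner_right_eq_inner_inv {L Linv : EuclideanSpace ℝ (Fin 3) →L[ℝ] EuclideanSpace ℝ (Fin 3)} (hL : ∀ w, ‖L w‖ = ‖w‖)
    (h1 : ∀ x, L (Linv x) = x) (x b : EuclideanSpace ℝ (Fin 3)) : ⟪x, L b⟫ = ⟪Linv x, b⟫ := by
  conv_lhs => rw [← h1 x]
  exact inner_map_map_of_norm_map L hL _ _

/-- **The body angular velocity `A = R⁻¹R′` is skew**: `⟪A a, b⟫ = −⟪a, A b⟫` (differentiate `⟪R(τ)a, R(τ)b⟫ = ⟪a, b⟫`). [folklore] -/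
theorem inner_bodyAngular_skew (hR : Differentiable ℝ R) (hRi : ∀ τ w, ‖R τ w‖ = ‖w‖) (h1 : ∀ τ x, R τ (Rinv τ x) = x)
    (τ : ℝ) (a b : EuclideanSpace ℝ (Fin 3)) :
    ⟪Rinv τ (deriv R τ a), b⟫ = -⟪a, Rinv τ (deriv R τ b)⟫ := by
  have ha : HasDerivAt (fun t : ℝ => R t a) (deriv R τ a) τ := by
    have h := (hR τ).hasDerivAt.clm_apply (hasDerivAt_const τ a); simpa using h
  have hb : HasDerivAt (fun t : ℝ => R t b) (deriv R τ b) τ := by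
    have h := (hR τ).hasDerivAt.clm_apply (hasDerivAt_const τ b); simpa using h
  have hprod := ha.inner ℝ hb
  have hconst : HasDerivAt (fun t : ℝ => ⟪R t a, R t b⟫) 0 τ := by
    have e : (fun t : ℝ => ⟪R t a, R t b⟫) = fun _ => ⟪a, b⟫ := funext fun t => inner_map_map_of_norm_map (R t) (hRi t) a b
    rw [e]; exact hasDerivAt_const τ _
  have h0 : ⟪R τ a, deriv R τ b⟫ + ⟪deriv R τ a, R τ b⟫ = 0 := by
    have := hprod.unique hconst
    simpa using this
  have t1 : ⟪R τ a, deriv R τ b⟫ = ⟪a, Rinv τ (deriv R τ b)⟫ := by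
    rw [real_inner_comm, inner_right_eq_inner_inv (hRi τ) (h1 τ), real_inner_comm]
  have t2 : ⟪deriv R τ a, R τ b⟫ = ⟪Rinv τ (deriv R τ a), b⟫ := inner_right_eq_inner_inv (hRi τ) (h1 τ) _ _
  rw [t1, t2] at h0
  linarith

/-- Conjugating by an invertible map does not change the trace: `tr (L M L⁻¹) = tr M`. [folklore] -/
theorem trace_conj_of_inverse (L Linv M : EuclideanSpace ℝ (Fin 3) →L[ℝ] EuclideanSpace ℝ (Fin 3)) (h2 : ∀ w, Linv (L w) = w) :
    LinearMap.trace ℝ (EuclideanSpace ℝ (Fin 3))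
        ((L.comp (M.comp Linv) : EuclideanSpace ℝ (Fin 3) →L[ℝ] EuclideanSpace ℝ (Fin 3)) :
          EuclideanSpace ℝ (Fin 3) →ₗ[ℝ] EuclideanSpace ℝ (Fin 3)) =
      LinearMap.trace ℝ (EuclideanSpace ℝ (Fin 3)) (M : EuclideanSpace ℝ (Fin 3) →ₗ[ℝ] EuclideanSpace ℝ (Fin 3)) := by
  have hinv : ((Linv : EuclideanSpace ℝ (Fin 3) →ₗ[ℝ] EuclideanSpace ℝ (Fin 3))) ∘ₗ
      ((L : EuclideanSpace ℝ (Fin 3) →ₗ[ℝ] EuclideanSpace ℝ (Fin 3))) = LinearMap.id := by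
    apply LinearMap.ext; intro v
    simp only [LinearMap.comp_apply, ContinuousLinearMap.coe_coe, LinearMap.id_apply]
    exact h2 v
  rw [show ((L.comp (M.comp Linv) : EuclideanSpace ℝ (Fin 3) →L[ℝ] EuclideanSpace ℝ (Fin 3)) :
        EuclideanSpace ℝ (Fin 3) →ₗ[ℝ] EuclideanSpace ℝ (Fin 3)) =
      (L : EuclideanSpace ℝ (Fin 3) →ₗ[ℝ] EuclideanSpace ℝ (Fin 3)) ∘ₗ
        ((M : EuclideanSpace ℝ (Fin 3) →ₗ[ℝ] EuclideanSpace ℝ (Fin 3)) ∘ₗ (Linv : EuclideanSpace ℝ (Fin 3) →ₗ[ℝ] EuclideanSpace ℝ (Fin 3)))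
      from rfl,
    LinearMap.trace_comp_comm', LinearMap.comp_assoc, hinv, LinearMap.comp_id]

/-! ### Transporting a body-frame test field to the lab frame -/

/-- The lab test field `x ↦ L Φ(L⁻¹(x − c))` has differential `L ∘ DΦ(L⁻¹(x − c)) ∘ L⁻¹`. [folklore] -/
theorem hasFDerivAt_labField (L Linv : EuclideanSpace ℝ (Fin 3) →L[ℝ] EuclideanSpace ℝ (Fin 3)) (c : EuclideanSpace ℝ (Fin 3))
    {Φ : EuclideanSpace ℝ (Fin 3) → EuclideanSpace ℝ (Fin 3)} (hΦ : Differentiable ℝ Φ) (x : EuclideanSpace ℝ (Fin 3)) :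
    HasFDerivAt (fun x => L (Φ (Linv (x - c)))) (L.comp ((fderiv ℝ Φ (Linv (x - c))).comp Linv)) x := by
  have h1 : HasFDerivAt (fun x => Linv (x - c)) Linv x := by
    have h := Linv.hasFDerivAt.comp x ((hasFDerivAt_id x).sub_const c)
    rw [ContinuousLinearMap.comp_id] at h
    exact h
  exact L.hasFDerivAt.comp x (((hΦ _).hasFDerivAt).comp x h1)

/-- The lab test field of a body test field is a test field; it is divergence free if the body field is. [folklore] -/
theorem isTestFunctionOn_labField {L Linv : EuclideanSpace ℝ (Fin 3) →L[ℝ] EuclideanSpace ℝ (Fin 3)}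
    (hLinv : ∀ w, ‖Linv w‖ = ‖w‖) (c : EuclideanSpace ℝ (Fin 3))
    {Φ : EuclideanSpace ℝ (Fin 3) → EuclideanSpace ℝ (Fin 3)} (hΦ : IsTestFunctionOn (⊤ : Opens (EuclideanSpace ℝ (Fin 3))) Φ) :
    IsTestFunctionOn (⊤ : Opens (EuclideanSpace ℝ (Fin 3))) (fun x => L (Φ (Linv (x - c)))) where
  contDiff := L.contDiff.comp (hΦ.contDiff.comp (Linv.contDiff.comp (contDiff_id.sub contDiff_const)))
  hasCompactSupport := by
    obtain ⟨R₀, hR₀⟩ := (hΦ.hasCompactSupport.isCompact.isBounded).subset_closedBall (0 : EuclideanSpace ℝ (Fin 3))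
    refine HasCompactSupport.intro (isCompact_closedBall (0 : EuclideanSpace ℝ (Fin 3)) (R₀ + ‖c‖)) fun x hx => ?_
    have hΦ0 : Φ (Linv (x - c)) = 0 := by
      by_contra hne
      have h1 : ‖Linv (x - c)‖ ≤ R₀ := mem_closedBall_zero_iff.1 (hR₀ (subset_tsupport _ (mem_support.2 hne)))
      rw [hLinv] at h1
      have h2 : ‖x‖ ≤ ‖x - c‖ + ‖c‖ := norm_le_norm_sub_add x c
      exact hx (mem_closedBall_zero_iff.2 (by linarith))
    rw [hΦ0, map_zero]
  tsupport_subset := by simp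

/-! ### The body-frame identity -/

/-- **STEADY EULER IN A RIGIDLY MOVING FRAME (weak form).**  For a rigid-frame-steady member `u(τ, x) = R(τ) U(R(τ)⁻¹(x − ξ(τ)))` of a distributional
Euler pair (`R, ξ ∈ C¹`; `U, |U|² ∈ L¹_loc`) and every divergence-free test field `Φ`, at every `τ < T₁`:
`∫ ⟪U, DΦ(w)(R⁻¹R′ w + R⁻¹ξ′) − R⁻¹R′ Φ(w)⟫ dw = ∫ ⟪U, DΦ(w) U(w)⟫ dw`. [folklore; MajdaBertozzi2002 Prop. 1.1] -/
theorem bodyFrame_identity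
    (hsol : IsDistributionalNSSolutionOn (slab (EuclideanSpace ℝ (Fin 3)) (Iio 0) isOpen_Iio) 0 0 u p)
    (hT₁ : T₁ ≤ 0) (hu : ∀ τ : ℝ, τ < T₁ → u τ = fun x => R τ (U (Rinv τ (x - ξ τ))))
    (hUm : AEStronglyMeasurable U volume) (hU : LocallyIntegrable U volume)
    (hU2 : LocallyIntegrable (fun z => ‖U z‖ ^ 2) volume) (hξ : ContDiff ℝ 1 ξ)
    (hR : ContDiff ℝ 1 R) (hRinv : Continuous Rinv) (hRi : ∀ τ w, ‖R τ w‖ = ‖w‖)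
    (h1 : ∀ τ x, R τ (Rinv τ x) = x) (h2 : ∀ τ w, Rinv τ (R τ w) = w)
    {Φ : EuclideanSpace ℝ (Fin 3) → EuclideanSpace ℝ (Fin 3)} (hΦ : IsTestFunctionOn (⊤ : Opens (EuclideanSpace ℝ (Fin 3))) Φ)
    (hdiv : ∀ z, VectorCalculus.divergence Φ z = 0) {τ : ℝ} (hτ : τ < T₁) :
    ∫ w, ⟪U w, (fderiv ℝ Φ w) (Rinv τ (deriv R τ w) + Rinv τ (deriv ξ τ)) - Rinv τ (deriv R τ (Φ w))⟫ =
      ∫ w, ⟪U w, (fderiv ℝ Φ w) (U w)⟫ := by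
  have hΦd : Differentiable ℝ Φ := hΦ.contDiff.differentiable (by simp)
  have hRinvi : ∀ t x, ‖Rinv t x‖ = ‖x‖ := fun t x => by rw [← hRi t (Rinv t x), h1]
  -- the lab test field `Φ_lab(x) = R Φ(R⁻¹(x − ξ))` at the frozen time `τ`
  have hlab := isTestFunctionOn_labField (L := R τ) (Linv := Rinv τ) (hRinvi τ) (ξ τ) hΦ
  have hfd : ∀ x, fderiv ℝ (fun x => R τ (Φ (Rinv τ (x - ξ τ)))) x = (R τ).comp ((fderiv ℝ Φ (Rinv τ (x - ξ τ))).comp (Rinv τ)) :=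
    fun x => (hasFDerivAt_labField (R τ) (Rinv τ) (ξ τ) hΦd x).fderiv
  have hdiv' : ∀ z, VectorCalculus.divergence (fun x => R τ (Φ (Rinv τ (x - ξ τ)))) z = 0 := fun z => by
    unfold VectorCalculus.divergence
    rw [hfd, trace_conj_of_inverse (R τ) (Rinv τ) _ (h2 τ)]
    exact hdiv _
  have key := integral_inner_fderiv_rigid_eq hsol hT₁ hu hUm hU hU2 hξ hR hRinv hRi h1 h2 hlab hdiv' hτ
  -- evaluate the lab field along `x = R w + ξ`
  have ev0 : ∀ w, Rinv τ (R τ w + ξ τ - ξ τ) = w := fun w => by rw [add_sub_cancel_right]; exact h2 τ w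
  have evΦ : ∀ w, R τ (Φ (Rinv τ (R τ w + ξ τ - ξ τ))) = R τ (Φ w) := fun w => by rw [ev0]
  have evD : ∀ w v, (fderiv ℝ (fun x => R τ (Φ (Rinv τ (x - ξ τ)))) (R τ w + ξ τ)) v = R τ ((fderiv ℝ Φ w) (Rinv τ v)) :=
    fun w v => by rw [hfd, ContinuousLinearMap.comp_apply, ContinuousLinearMap.comp_apply, ev0]
  have hRa : ∀ x y : EuclideanSpace ℝ (Fin 3), Rinv τ (x + y) = Rinv τ x + Rinv τ y := fun x y => map_add _ x y
  simp only [evΦ, evD] at key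
  simp only [inner_map_map_of_norm_map (R τ) (hRi τ), h2, hRa] at key
  -- `key : ∫⟪U, DΦ w (U w)⟫ = ∫⟪R′U, R Φ⟫ + ∫⟪U, DΦ w (R⁻¹R′w + R⁻¹ξ′)⟫`
  rw [key]
  have i1 : Integrable (fun w => ⟪U w, (fderiv ℝ Φ w) (Rinv τ (deriv R τ w) + Rinv τ (deriv ξ τ))⟫) volume := by
    refine integrable_inner_of_locallyIntegrable_of_hasCompactSupport hU
      ((hΦ.contDiff.continuous_fderiv (by simp)).clm_apply
        (((Rinv τ).continuous.comp (deriv R τ).continuous).add continuous_const)) ?_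
    refine (hΦ.hasCompactSupport.fderiv (𝕜 := ℝ)).mono fun x hx => ?_
    by_contra h0
    exact hx (by simp only [Function.notMem_support.1 h0, zero_apply])
  have i2 : Integrable (fun w => ⟪U w, Rinv τ (deriv R τ (Φ w))⟫) volume :=
    integrable_inner_of_locallyIntegrable_of_hasCompactSupport hU
      ((Rinv τ).continuous.comp ((deriv R τ).continuous.comp hΦ.contDiff.continuous))
      ((hΦ.hasCompactSupport.comp_left (map_zero _)).comp_left (map_zero _))
  have e1 : (fun w => ⟪U w, (fderiv ℝ Φ w) (Rinv τ (deriv R τ w) + Rinv τ (deriv ξ τ)) - Rinv τ (deriv R τ (Φ w))⟫) =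
      fun w => ⟪U w, (fderiv ℝ Φ w) (Rinv τ (deriv R τ w) + Rinv τ (deriv ξ τ))⟫ - ⟪U w, Rinv τ (deriv R τ (Φ w))⟫ := by
    funext w; rw [inner_sub_right]
  have e2 : (fun w => ⟪deriv R τ (U w), R τ (Φ w)⟫) = fun w => -⟪U w, Rinv τ (deriv R τ (Φ w))⟫ := by
    funext w
    rw [inner_right_eq_inner_inv (hRi τ) (h1 τ), inner_bodyAngular_skew (hR.differentiable (by simp)) hRi h1]
  rw [e1, integral_sub i1 i2, e2, integral_neg]
  ring

/-- **THE LIE DERIVATIVE OF THE PROFILE ALONG A KILLING FIELD IS WEAKLY A GRADIENT (two-time difference).**  With the notation of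
`bodyFrame_identity`, for `τ₁, τ₂ < T₁` and every divergence-free test field `Φ`:
`∫ ⟪U, DΦ(w)((A₁ − A₂) w + (v₁ − v₂)) − (A₁ − A₂) Φ(w)⟫ dw = 0`, `Aᵢ = R(τᵢ)⁻¹R′(τᵢ)`, `vᵢ = R(τᵢ)⁻¹ξ′(τᵢ)`. [folklore] -/
theorem bodyFrame_twoTime
    (hsol : IsDistributionalNSSolutionOn (slab (EuclideanSpace ℝ (Fin 3)) (Iio 0) isOpen_Iio) 0 0 u p)
    (hT₁ : T₁ ≤ 0) (hu : ∀ τ : ℝ, τ < T₁ → u τ = fun x => R τ (U (Rinv τ (x - ξ τ))))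
    (hUm : AEStronglyMeasurable U volume) (hU : LocallyIntegrable U volume)
    (hU2 : LocallyIntegrable (fun z => ‖U z‖ ^ 2) volume) (hξ : ContDiff ℝ 1 ξ)
    (hR : ContDiff ℝ 1 R) (hRinv : Continuous Rinv) (hRi : ∀ τ w, ‖R τ w‖ = ‖w‖)
    (h1 : ∀ τ x, R τ (Rinv τ x) = x) (h2 : ∀ τ w, Rinv τ (R τ w) = w)
    {Φ : EuclideanSpace ℝ (Fin 3) → EuclideanSpace ℝ (Fin 3)} (hΦ : IsTestFunctionOn (⊤ : Opens (EuclideanSpace ℝ (Fin 3))) Φ)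
    (hdiv : ∀ z, VectorCalculus.divergence Φ z = 0) {τ₁ τ₂ : ℝ} (hτ₁ : τ₁ < T₁) (hτ₂ : τ₂ < T₁) :
    ∫ w, ⟪U w, (fderiv ℝ Φ w) ((Rinv τ₁ (deriv R τ₁ w) - Rinv τ₂ (deriv R τ₂ w)) + (Rinv τ₁ (deriv ξ τ₁) - Rinv τ₂ (deriv ξ τ₂))) -
      (Rinv τ₁ (deriv R τ₁ (Φ w)) - Rinv τ₂ (deriv R τ₂ (Φ w)))⟫ = 0 := by
  have k₁ := bodyFrame_identity hsol hT₁ hu hUm hU hU2 hξ hR hRinv hRi h1 h2 hΦ hdiv hτ₁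
  have k₂ := bodyFrame_identity hsol hT₁ hu hUm hU hU2 hξ hR hRinv hRi h1 h2 hΦ hdiv hτ₂
  have i : ∀ t : ℝ, Integrable (fun w => ⟪U w, (fderiv ℝ Φ w) (Rinv t (deriv R t w) + Rinv t (deriv ξ t)) -
      Rinv t (deriv R t (Φ w))⟫) volume := by
    intro t
    have j1 : Integrable (fun w => ⟪U w, (fderiv ℝ Φ w) (Rinv t (deriv R t w) + Rinv t (deriv ξ t))⟫) volume := by
      refine integrable_inner_of_locallyIntegrable_of_hasCompactSupport hU
        ((hΦ.contDiff.continuous_fderiv (by simp)).clm_apply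
          (((Rinv t).continuous.comp (deriv R t).continuous).add continuous_const)) ?_
      refine (hΦ.hasCompactSupport.fderiv (𝕜 := ℝ)).mono fun x hx => ?_
      by_contra h0
      exact hx (by simp only [Function.notMem_support.1 h0, zero_apply])
    have j2 : Integrable (fun w => ⟪U w, Rinv t (deriv R t (Φ w))⟫) volume :=
      integrable_inner_of_locallyIntegrable_of_hasCompactSupport hU
        ((Rinv t).continuous.comp ((deriv R t).continuous.comp hΦ.contDiff.continuous))
        ((hΦ.hasCompactSupport.comp_left (map_zero _)).comp_left (map_zero _))
    have e : (fun w => ⟪U w, (fderiv ℝ Φ w) (Rinv t (deriv R t w) + Rinv t (deriv ξ t)) - Rinv t (deriv R t (Φ w))⟫) =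
        fun w => ⟪U w, (fderiv ℝ Φ w) (Rinv t (deriv R t w) + Rinv t (deriv ξ t))⟫ - ⟪U w, Rinv t (deriv R t (Φ w))⟫ := by
      funext w; rw [inner_sub_right]
    rw [e]; exact j1.sub j2
  have e : (fun w => ⟪U w, (fderiv ℝ Φ w) ((Rinv τ₁ (deriv R τ₁ w) - Rinv τ₂ (deriv R τ₂ w)) +
        (Rinv τ₁ (deriv ξ τ₁) - Rinv τ₂ (deriv ξ τ₂))) - (Rinv τ₁ (deriv R τ₁ (Φ w)) - Rinv τ₂ (deriv R τ₂ (Φ w)))⟫) =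
      fun w => ⟪U w, (fderiv ℝ Φ w) (Rinv τ₁ (deriv R τ₁ w) + Rinv τ₁ (deriv ξ τ₁)) - Rinv τ₁ (deriv R τ₁ (Φ w))⟫ -
        ⟪U w, (fderiv ℝ Φ w) (Rinv τ₂ (deriv R τ₂ w) + Rinv τ₂ (deriv ξ τ₂)) - Rinv τ₂ (deriv R τ₂ (Φ w))⟫ := by
    funext w
    rw [← inner_sub_right]
    congr 1
    simp only [map_add, map_sub]
    abel
  rw [e, integral_sub (i τ₁) (i τ₂), k₁, k₂, sub_self]

/-- **THE PROFILE OF A RIGID-FRAME-STEADY MEMBER IS WEAKLY DIVERGENCE FREE**: `∫ ⟪U, ∇φ⟫ = 0` for every smooth compactly supported `φ`. [folklore] -/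
theorem rigidProfile_integral_inner_gradient_eq_zero
    (hsol : IsDistributionalNSSolutionOn (slab (EuclideanSpace ℝ (Fin 3)) (Iio 0) isOpen_Iio) 0 0 u p)
    (hT₁ : T₁ ≤ 0) (hu : ∀ τ : ℝ, τ < T₁ → u τ = fun x => R τ (U (Rinv τ (x - ξ τ))))
    (hU : LocallyIntegrable U volume) (hξ : Continuous ξ)
    (hR : Continuous R) (hRinv : Continuous Rinv) (hRi : ∀ τ w, ‖R τ w‖ = ‖w‖)
    (h1 : ∀ τ x, R τ (Rinv τ x) = x) (h2 : ∀ τ w, Rinv τ (R τ w) = w)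
    {φ : EuclideanSpace ℝ (Fin 3) → ℝ} (hφ : ContDiff ℝ (⊤ : ℕ∞) φ) (hφc : HasCompactSupport φ) :
    ∫ z, ⟪U z, gradient φ z⟫ = 0 := by
  have hT : T₁ - 1 < T₁ := by linarith
  -- the shifted pairing vanishes at every `τ < T₁`
  have key : ∀ ψ : EuclideanSpace ℝ (Fin 3) → ℝ, IsTestFunctionOn (⊤ : Opens (EuclideanSpace ℝ (Fin 3))) ψ →
      ∀ t, t < T₁ → ∫ w, ⟪R t (U w), gradient ψ (R t w + ξ t)⟫ = 0 := by
    intro ψ hψ t ht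
    have hG := isTestFunctionOn_gradient_field hψ
    have hN : Continuous fun s : ℝ => ∫ w, ⟪R s (U w), gradient ψ (R s w + ξ s)⟫ :=
      continuous_integral_inner_rigid_path hU hξ hR hRi hR hG.contDiff.continuous hG.hasCompactSupport
    exact eq_of_integral_deriv_mul_add_eq_zero (f := fun _ => (0 : ℝ)) (g := fun _ => (0 : ℝ))
      (N := fun s => ∫ w, ⟪R s (U w), gradient ψ (R s w + ξ s)⟫) (fun s => hasDerivAt_const s (0 : ℝ)) continuous_const hN
      (fun χ hχ hχc hχT => by
        simp only [mul_zero, zero_add]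
        exact integral_scalarTensorTest_rigid hsol hT₁ hu hU hξ hR hRinv hRi h1 h2 hψ hχ hχc hχT) ht
  -- the body scalar `ψ(x) = φ(R⁻¹(x − ξ))` at the time `t₀ = T₁ − 1`
  set t₀ : ℝ := T₁ - 1 with ht₀
  have hRinvi : ∀ x, ‖Rinv t₀ x‖ = ‖x‖ := fun x => by rw [← hRi t₀ (Rinv t₀ x), h1]
  have hφd : Differentiable ℝ φ := hφ.differentiable (by simp)
  have hψ : IsTestFunctionOn (⊤ : Opens (EuclideanSpace ℝ (Fin 3))) (fun x => φ (Rinv t₀ (x - ξ t₀))) :=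
    { contDiff := hφ.comp ((Rinv t₀).contDiff.comp (contDiff_id.sub contDiff_const))
      hasCompactSupport := by
        obtain ⟨R₀, hR₀⟩ := (hφc.isCompact.isBounded).subset_closedBall (0 : EuclideanSpace ℝ (Fin 3))
        refine HasCompactSupport.intro (isCompact_closedBall (0 : EuclideanSpace ℝ (Fin 3)) (R₀ + ‖ξ t₀‖)) fun x hx => ?_
        by_contra hne
        have h3 : ‖Rinv t₀ (x - ξ t₀)‖ ≤ R₀ := mem_closedBall_zero_iff.1 (hR₀ (subset_tsupport _ (mem_support.2 hne)))
        rw [hRinvi] at h3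
        have h4 : ‖x‖ ≤ ‖x - ξ t₀‖ + ‖ξ t₀‖ := norm_le_norm_sub_add x (ξ t₀)
        exact hx (mem_closedBall_zero_iff.2 (by linarith))
      tsupport_subset := by simp }
  have h := key _ hψ t₀ hT
  -- `∇ψ(R w + ξ) = R ∇φ(w)` and `⟪R U, R ∇φ⟫ = ⟪U, ∇φ⟫`
  have hgr : ∀ w, gradient (fun x => φ (Rinv t₀ (x - ξ t₀))) (R t₀ w + ξ t₀) = R t₀ (gradient φ w) := by
    intro w
    have hd : HasFDerivAt (fun x => φ (Rinv t₀ (x - ξ t₀)))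
        ((fderiv ℝ φ (Rinv t₀ (R t₀ w + ξ t₀ - ξ t₀))).comp (Rinv t₀)) (R t₀ w + ξ t₀) := by
      have hin : HasFDerivAt (fun x => Rinv t₀ (x - ξ t₀)) (Rinv t₀) (R t₀ w + ξ t₀) := by
        have h := (Rinv t₀).hasFDerivAt.comp (R t₀ w + ξ t₀) ((hasFDerivAt_id (R t₀ w + ξ t₀)).sub_const (ξ t₀))
        rw [ContinuousLinearMap.comp_id] at h
        exact h
      exact ((hφd _).hasFDerivAt).comp _ hin
    apply ext_inner_right ℝ
    intro v
    rw [gradient, hd.fderiv, InnerProductSpace.toDual_symm_apply, ContinuousLinearMap.comp_apply, add_sub_cancel_right, h2]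
    conv_rhs => rw [← h1 t₀ v]
    rw [inner_map_map_of_norm_map (R t₀) (hRi t₀), gradient, InnerProductSpace.toDual_symm_apply]
  simp only [hgr, inner_map_map_of_norm_map (R t₀) (hRi t₀)] at h
  exact h

end RigidFrame

end Summit.NavierStokesRegularity.NavierStokesRegularity.Theorems.PowerGaugeEulerLiouville

end
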